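import Literature.Geometry.Symplectic.SteinBoundaryContact
import Literature.Topology.FourManifolds.Isotopy
import HarnessLib

/-!
# Isotopies of knots and links in the boundary of a Stein domain, and stabilisation of
# Legendrian knots (Gompf 1998, §1), as used by Akbulut–Matveyev (1998), §§3–4

Topic `Literature/Geometry/Symplectic`; the vocabulary of (`C⁰`-small) isotopies of knots and
links in `∂W` with framings carried along, and ONE named fact of the layer below Theorem 3 of
Akbulut–Matveyev (1998) (`AkbulutMatveyev.lean`, `Literature.Geometry.Symplectic.AkbulutMatveyev1998_thm3`,
fact seat `provefact-Literature.Geometry.Symplectic.akbulut_m…`), in the vocabulary of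
`SteinBoundaryContact.lean` (complex tangencies `contactPlane`, `IsLegendrianKnot`, framings
`IsKnotFraming`, the twisting number `SteinStructure.twisting` of a framing relative to the
canonical framing, the defect `SteinStructure.defect`) and of `Isotopy.lean`
(`Literature.Topology.FourManifolds.SmoothIsotopy`).

The printed proof of AM Thm. 3 (§4) begins: *"Let `Yᵢ` be a union of 0- and 1-handles in `Xᵢ`.
According to theorem of Eliashberg `Yᵢ` is a PC manifold. … Since every curve in contact
manifold is isotopic to a Legendrian curve via smooth `C⁰`-small isotopy, we can assume that
2-handles in handlebodies of `Xᵢ` are attached to Legendrian knots in `∂Yᵢ`"*, and §3 uses: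
*"If `tb(K) ≥ f + 1` then by `C⁰`-small smooth isotopy of `K` we can decrease Thurston–Bennequin
invariant of `K` and make it equal to `f + 1`.  Therefore, by a theorem of Eliashberg, manifold
`Z ∪ h` possesses PC structure."*  Both sentences are standard contact topology, printed with
their proofs' one-line summaries in Gompf (1998), §1 (p. 4 of arXiv:math/9803019):

> *"Any link in a contact 3-manifold is `C⁰`-small isotopic to a (nonunique) Legendrian link.
> (Simply replace each arc transverse to `ξ` by a (left-handed) Legendrian spiral.) … For any
> Legendrian knot `K`, we can find a `C⁰`-small isotopy (necessarily changing its Legendrian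
> knot type) that adds any number of left (negative) twists to the canonical framing — or in
> the nullhomologous case, decreases `tb(K)` by any integer. (Simply add a spiral to `K`.)"*

The contact 3-manifold at hand is the boundary `∂W` of a compact Stein domain `W` with its
complex tangencies `ξ = T∂W ∩ J T∂W` (AM §1: *"Boundary `∂X` of PC manifold `X` inherits a
contact structure `ξ`, which, in this case, is a distribution of maximal complex subspaces in
`TX` tangent to `∂X`"*).  The second sentence is recorded as the named fact

* `Literature.Geometry.Symplectic.Gompf1998_addLeftTwists` — a Legendrian knot in `∂W` is
  `C⁰`-small isotopic, through knots in `∂W`, to a Legendrian knot in such a way that any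
  framing carried along the isotopy gains `n` right-handed twists relative to the canonical
  framing (the canonical framing acquires `n` left twists; `tb` drops by `n`): in the tree's
  normalisation, `twisting` increases by `n`,

and the consequence used in AM §3 is **proved** from it
(`Gompf1998_addLeftTwists.exists_twisting_eq_neg_one`): a Legendrian knot with a framing of
defect `0` (`twisting ≤ -1`, `SteinStructure.defect_eq_zero_iff`) is `C⁰`-small isotopic to a
Legendrian knot for which the carried framing has twisting exactly `-1`, i.e. is "one less than
Thurston–Bennequin", the hypothesis of Eliashberg's theorem (AM Thm. 2 (2); Gompf Thm. 1.3 (c)).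

## Legendrian realisation of links: merged back into the parent (review D-0026, 2026-08-15)

The first sentence — Legendrian `C⁰`-small realisation of arbitrary smooth links, the step
*"we can assume that 2-handles in handlebodies of `Xᵢ` are attached to Legendrian knots in
`∂Yᵢ`"* of the proof of AM Thm. 3 — was formerly recorded here as a second named fact,
`Gompf1998_legendrianRealisation`: for every Stein structure `S` on a compact Hausdorff `W`,
every finite smooth link `L` in `∂W` (`IsBoundaryLink`) and every family of open sets
`𝒪 i ⊆ S¹ × W` containing the graphs of the components, there are a link `L'` all of whose
components are Legendrian for `S.J` (`IsLegendrianKnot`) and an `𝒪`-small isotopy of links in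
`∂W` from `L` to `L'` (`LinkIsotopyInBoundary`, `LinkIsotopyInBoundary.IsSmall`).  That
rendering was checked faithful to the printed sentence (a specialisation of "contact
3-manifold" to Stein boundaries) and non-vacuous (`steinStructureClosedBall`, `SteinBall.lean`),
but it is a theorem of a theory the tree does not have — `∂W` as a closed 3-manifold
(invariance of the boundary for `𝓡∂ 4`-charts), the contact condition of `ξ` from
`J`-convexity at the level of forms on `∂W`, Darboux charts / front projections or Gompf's
spirals with smoothing, embeddedness and joint smoothness of the resulting isotopy with `C⁰`
control, patched over finitely many charts (Etnyre 2003, Thm. 2.5 is the textbook proof: fronts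
with zig-zags in a Darboux chart) — and no declaration of the tree consumed it.  Under the
fact-decomposition discipline (D-0026: decomposition children must be M-sized and decompositions
do not recurse) it has therefore been merged back into the proof obligation of its parent
`AkbulutMatveyev1998_thm3` (itself a named fact), where the sentence sits in print; the
vocabulary below, in which it was phrased, stays
(it serves `Gompf1998_addLeftTwists`, `TwoHandleIsotopy.lean`, `SteinTwoHandles.lean`,
`DefectZeroProofs.lean`), and the trivial case of an already Legendrian link remains a theorem
(`exists_linkIsotopyInBoundary_of_isLegendrianKnot`).  A future consumer re-vendors the
statement above verbatim through a granted split, not as a side effect.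

## Vocabulary (definitions, all with the obvious `refl` API proved)

* `IsBoundaryKnot K` — a smooth embedding `K : S¹ → W` with values in `∂W`;
  `IsBoundaryLink L` — a family `L : ι → S¹ → W` of boundary knots with pairwise disjoint
  images (Gompf's `L : ∐ⁿ S¹ ↪ M`);
* `KnotIsotopyInBoundary K K'` — a smooth isotopy (`SmoothIsotopy`, jointly `C^∞`, every stage
  a smooth embedding, time over `ℝ` with only `[0, 1]` relevant — the convention of
  `Isotopy.lean`) all of whose stages `t ∈ [0, 1]` lie in `∂W`; `LinkIsotopyInBoundary L L'` —
  componentwise such isotopies whose stages are links (components stay disjoint);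
* `C⁰`-smallness is phrased through **graph neighbourhoods**: given open sets
  `𝒪 i ⊆ S¹ × W` containing the graphs `{(u, L i u)}`, the isotopy is *`𝒪`-small* if the graph
  of every stage `t ∈ [0, 1]` of component `i` stays in `𝒪 i`.  For the compact domain `S¹`
  the sets `{g | graph g ⊆ 𝒪}` form a basis of neighbourhoods of `L i` in the compact-open
  (`C⁰`) topology, so "for every such `𝒪` there is an `𝒪`-small isotopy" is exactly
  "`C⁰`-small isotopic"; this avoids carrying continuity certificates inside the statements;
* `IsFramingAlong Φ ν νt` — a framing `ν` of `K` *carried along* the isotopy `Φ`: a family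
  `νt t` of framings (`IsKnotFraming`) of the stages, continuous on `[0, 1] × S¹` into `TW`,
  with `νt 0 = ν` (so `νt 1` is the framing of `K'` "corresponding to" `ν`; any framing can be
  carried along any isotopy of knots by isotopy extension, which is not asserted here).

## Rendering notes

* Gompf's `(M, ξ)` is any (closed, oriented) contact 3-manifold; here `M = ∂W` with the complex
  tangencies of a Stein structure, which is a contact structure (AM §1; Cieliebak–Eliashberg
  2012, Ch. 2) — the tree does not prove the contact condition and the fact does not need it as
  a hypothesis, the Stein structure `S` being the datum.  `W` is taken Hausdorff (`T2Space`).
* "adds `n` left twists to the canonical framing" is rendered on an arbitrary framing `ν`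
  carried along the isotopy: the relative twisting of two framings carried along one isotopy
  is constant, and the canonical framing has twisting `0`
  (`IsLegendrianKnot.twistingLoop_canonicalFraming`), so the carried framing `νt 1` has
  twisting `twisting K ν + n` relative to the canonical framing of the new Legendrian knot `K'`
  (`SteinStructure.twisting` counts right-handed twists relative to the canonical framing;
  Gompf's "single left twist" of Thm. 1.3 (c) is twisting `-1`).  The isotopy is allowed to
  depend on `ν` (weaker than print, where one isotopy serves all framings).
* Not recorded: Legendrian realisation of links (merged back into the parent, see above);
  Eliashberg's theorem with 2-handles (AM Thm. 2 (2) / Gompf Thm. 1.3 (b)–(c)), which needs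
  the attachment of a 4-dimensional 2-handle along a prescribed framed knot (recorded
  separately, `SteinTwoHandles.lean`); uniqueness statements; the overtwisted/tight dichotomy
  of the rest of Gompf's §1.

## References

* R. E. Gompf, *Handlebody construction of Stein surfaces*, Ann. of Math. 148 (1998), 619–693
  (arXiv:math/9803019), §1, p. 4. [Gompf1998]
* S. Akbulut, R. Matveyev, *A convex decomposition theorem for 4-manifolds*, IMRN 1998, no. 7,
  371–381 (arXiv:math/0010166), §1, §3, §4 (proof of Thm. 3). [AkbulutMatveyev1998]
* K. Cieliebak, Ya. Eliashberg, *From Stein to Weinstein and back*, AMS Colloquium Publ. 59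
  (2012), Ch. 2. [CieliebakEliashberg2012]
* J. B. Etnyre, *Legendrian and transversal knots*, arXiv:math/0306256 (2003; in: Handbook
  of Knot Theory, Elsevier (2005), 105–185), Thm. 2.5, p. 7 of the arXiv version ("Given any
  topological knot `K` there is a Legendrian knot `C⁰` close to it", via front projections and
  Darboux's theorem). [Etnyre2003]
-/

noncomputable section

open scoped Manifold ContDiff Topology
open Set Function

namespace Literature.Geometry.Symplectic

/-- The model vector space `ℝ⁴` of the tangent spaces. [folklore] -/
local notation "E4" => EuclideanSpace ℝ (Fin 4)

/-- Local notation: `𝕊 n` is the unit sphere in `EuclideanSpace ℝ (Fin (n + 1))`. -/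
local notation "𝕊 " n:arg => (Metric.sphere (0 : EuclideanSpace ℝ (Fin (n + 1))) 1)

variable {W : Type*} [TopologicalSpace W] [ChartedSpace (EuclideanHalfSpace 4) W]

/-! ### Knots and links in the boundary -/

/-- **A (smooth) knot in the boundary `∂W`**: a `C^∞` embedding `K : S¹ → W` all of whose
values are boundary points (a knot in the 3-manifold `∂W`, which the tree only knows as the
subset `(𝓡∂ 4).boundary W`). [folklore] -/
structure IsBoundaryKnot (K : 𝕊 1 → W) : Prop where
  /-- `K` is a `C^∞` embedding -/
  isSmoothEmbedding : Manifold.IsSmoothEmbedding (𝓡 1) (𝓡∂ 4) ∞ K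
  /-- `K` lies in the boundary -/
  isBoundaryPoint : ∀ u, (𝓡∂ 4).IsBoundaryPoint (K u)

/-- **A (smooth) link in the boundary `∂W`** with components indexed by `ι`
(Gompf: `L : ∐ᵢ S¹ ↪ M`): every component is a knot in `∂W` and distinct components have
disjoint images. [cite: Gompf1998, §1] -/
structure IsBoundaryLink {ι : Type*} (L : ι → 𝕊 1 → W) : Prop where
  /-- every component is a knot in `∂W` -/
  isBoundaryKnot : ∀ i, IsBoundaryKnot (L i)
  /-- distinct components are disjoint -/
  disjoint : Pairwise fun i j => Disjoint (range (L i)) (range (L j))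

/-- A Legendrian knot (`IsLegendrianKnot`) is in particular a knot in the boundary. [folklore] -/
theorem IsLegendrianKnot.isBoundaryKnot {J : (x : W) → (E4 →L[ℝ] E4)} {K : 𝕊 1 → W}
    (hK : IsLegendrianKnot J K) : IsBoundaryKnot K :=
  ⟨hK.isSmoothEmbedding, hK.isBoundaryPoint⟩

/-- A single knot in the boundary is a one-component link in the boundary. [folklore] -/
theorem IsBoundaryKnot.isBoundaryLink {ι : Type*} [Subsingleton ι] {K : 𝕊 1 → W}
    (hK : IsBoundaryKnot K) : IsBoundaryLink fun _ : ι => K :=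
  ⟨fun _ => hK, fun _ _ hij => absurd (Subsingleton.elim _ _) hij⟩

/-- The components of a link in the boundary are knots in the boundary. [folklore] -/
theorem IsBoundaryLink.isBoundaryKnot_apply {ι : Type*} {L : ι → 𝕊 1 → W} (hL : IsBoundaryLink L)
    (i : ι) : IsBoundaryKnot (L i) :=
  hL.isBoundaryKnot i

/-! ### Isotopies of knots and links in the boundary -/

/-- **An isotopy of knots in `∂W`** from `K` to `K'`: a smooth isotopy of embeddings
`S¹ → W` (`Literature.Topology.FourManifolds.SmoothIsotopy`: jointly `C^∞`, every stage a
`C^∞` embedding, `F 0 = K`, `F 1 = K'`; time over `ℝ`, only `[0, 1]` relevant) all of whose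
stages `t ∈ [0, 1]` take values in the boundary. [folklore] -/
structure KnotIsotopyInBoundary (K K' : 𝕊 1 → W)
    extends Literature.Topology.FourManifolds.SmoothIsotopy (𝓡 1) (𝓡∂ 4) K K' where
  /-- the stages `t ∈ [0, 1]` lie in the boundary -/
  isBoundaryPoint : ∀ t ∈ Icc (0 : ℝ) 1, ∀ u, (𝓡∂ 4).IsBoundaryPoint (toFun t u)

/-- **An isotopy of links in `∂W`** from `L` to `L'`: an isotopy of knots in `∂W` for every
component, the stages `t ∈ [0, 1]` being links (the components stay pairwise disjoint) —
Gompf's "isotopic (through links)". [cite: Gompf1998, §1] -/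
structure LinkIsotopyInBoundary {ι : Type*} (L L' : ι → 𝕊 1 → W) where
  /-- the isotopy of the `i`-th component -/
  isotopy : ∀ i, KnotIsotopyInBoundary (L i) (L' i)
  /-- at each time `t ∈ [0, 1]` the components are pairwise disjoint -/
  disjoint : ∀ t ∈ Icc (0 : ℝ) 1,
    Pairwise fun i j => Disjoint (range ((isotopy i).toFun t)) (range ((isotopy j).toFun t))

namespace KnotIsotopyInBoundary

variable {K K' : 𝕊 1 → W}

/-- Every stage `t ∈ [0, 1]` of an isotopy of knots in `∂W` is a knot in `∂W`. [folklore] -/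
theorem isBoundaryKnot (Φ : KnotIsotopyInBoundary K K') {t : ℝ} (ht : t ∈ Icc (0 : ℝ) 1) :
    IsBoundaryKnot (Φ.toFun t) :=
  ⟨Φ.isSmoothEmbedding t, Φ.isBoundaryPoint t ht⟩

/-- The start of an isotopy of knots in `∂W` is a knot in `∂W`. [folklore] -/
theorem isBoundaryKnot_left (Φ : KnotIsotopyInBoundary K K') : IsBoundaryKnot K := by
  have h := Φ.isBoundaryKnot (t := 0) ⟨le_rfl, zero_le_one⟩
  rwa [Φ.map_zero] at h

/-- The end of an isotopy of knots in `∂W` is a knot in `∂W`. [folklore] -/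
theorem isBoundaryKnot_right (Φ : KnotIsotopyInBoundary K K') : IsBoundaryKnot K' := by
  have h := Φ.isBoundaryKnot (t := 1) ⟨zero_le_one, le_rfl⟩
  rwa [Φ.map_one] at h

/-- **The constant isotopy** at a knot in `∂W`. [folklore] -/
def refl (hK : IsBoundaryKnot K) : KnotIsotopyInBoundary K K where
  toSmoothIsotopy := Literature.Topology.FourManifolds.SmoothIsotopy.refl hK.isSmoothEmbedding
  isBoundaryPoint _ _ u := hK.isBoundaryPoint u

/-- Stages of the constant isotopy. [folklore] -/
@[simp] theorem refl_toFun (hK : IsBoundaryKnot K) (t : ℝ) : (refl hK).toFun t = K := rfl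

/-- **`𝒪`-smallness** of an isotopy of knots (`𝒪 ⊆ S¹ × W` an open set containing the graph of
`K`): the graph of every stage `t ∈ [0, 1]` lies in `𝒪`.  For all such `𝒪` at once this is
"`C⁰`-small" (graph neighbourhoods form a basis of the compact-open topology at a map of the
compact space `S¹`). [folklore] -/
def IsSmall (Φ : KnotIsotopyInBoundary K K') (𝒪 : Set ((𝕊 1) × W)) : Prop :=
  ∀ t ∈ Icc (0 : ℝ) 1, ∀ u, (u, Φ.toFun t u) ∈ 𝒪

/-- The constant isotopy is `𝒪`-small for every `𝒪` containing the graph of the knot. [folklore] -/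
theorem refl_isSmall (hK : IsBoundaryKnot K) {𝒪 : Set ((𝕊 1) × W)} (h𝒪 : ∀ u, (u, K u) ∈ 𝒪) :
    (refl hK).IsSmall 𝒪 :=
  fun _ _ u => h𝒪 u

end KnotIsotopyInBoundary

namespace LinkIsotopyInBoundary

variable {ι : Type*} {L L' : ι → 𝕊 1 → W}

/-- The stage at time `t` of an isotopy of links: the family of the stages of the components.
[folklore] -/
def stage (Φ : LinkIsotopyInBoundary L L') (t : ℝ) : ι → 𝕊 1 → W :=
  fun i => (Φ.isotopy i).toFun t

/-- Unfolding `stage`. [folklore] -/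
@[simp] theorem stage_apply (Φ : LinkIsotopyInBoundary L L') (t : ℝ) (i : ι) :
    Φ.stage t i = (Φ.isotopy i).toFun t := rfl

/-- The isotopy of links starts at `L`. [folklore] -/
@[simp] theorem stage_zero (Φ : LinkIsotopyInBoundary L L') : Φ.stage 0 = L :=
  funext fun i => (Φ.isotopy i).map_zero

/-- The isotopy of links ends at `L'`. [folklore] -/
@[simp] theorem stage_one (Φ : LinkIsotopyInBoundary L L') : Φ.stage 1 = L' :=
  funext fun i => (Φ.isotopy i).map_one

/-- Every stage `t ∈ [0, 1]` of an isotopy of links in `∂W` is a link in `∂W`. [folklore] -/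
theorem isBoundaryLink_stage (Φ : LinkIsotopyInBoundary L L') {t : ℝ} (ht : t ∈ Icc (0 : ℝ) 1) :
    IsBoundaryLink (Φ.stage t) :=
  ⟨fun i => (Φ.isotopy i).isBoundaryKnot ht, Φ.disjoint t ht⟩

/-- The start of an isotopy of links in `∂W` is a link in `∂W`. [folklore] -/
theorem isBoundaryLink_left (Φ : LinkIsotopyInBoundary L L') : IsBoundaryLink L := by
  have h := Φ.isBoundaryLink_stage (t := 0) ⟨le_rfl, zero_le_one⟩
  rwa [Φ.stage_zero] at h

/-- The end of an isotopy of links in `∂W` is a link in `∂W` (in particular a Legendrian link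
reached by an isotopy of links in `∂W` has pairwise disjoint components). [folklore] -/
theorem isBoundaryLink_right (Φ : LinkIsotopyInBoundary L L') : IsBoundaryLink L' := by
  have h := Φ.isBoundaryLink_stage (t := 1) ⟨zero_le_one, le_rfl⟩
  rwa [Φ.stage_one] at h

/-- **The constant isotopy** at a link in `∂W`. [folklore] -/
def refl (hL : IsBoundaryLink L) : LinkIsotopyInBoundary L L where
  isotopy i := KnotIsotopyInBoundary.refl (hL.isBoundaryKnot i)
  disjoint _ _ := hL.disjoint

/-- Stages of the constant isotopy. [folklore] -/
@[simp] theorem refl_stage (hL : IsBoundaryLink L) (t : ℝ) : (refl hL).stage t = L := rfl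

/-- **`𝒪`-smallness** of an isotopy of links (`𝒪 i ⊆ S¹ × W` open sets containing the graphs
of the components `L i`): every component isotopy is `𝒪 i`-small, i.e. the graph of every
stage `t ∈ [0, 1]` of component `i` lies in `𝒪 i` ("`C⁰`-small", see
`KnotIsotopyInBoundary.IsSmall`). [folklore] -/
def IsSmall (Φ : LinkIsotopyInBoundary L L') (𝒪 : ι → Set ((𝕊 1) × W)) : Prop :=
  ∀ i, (Φ.isotopy i).IsSmall (𝒪 i)

/-- The constant isotopy is `𝒪`-small for every `𝒪` containing the graphs of the components.
[folklore] -/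
theorem refl_isSmall (hL : IsBoundaryLink L) {𝒪 : ι → Set ((𝕊 1) × W)}
    (h𝒪 : ∀ i u, (u, L i u) ∈ 𝒪 i) : (refl hL).IsSmall 𝒪 :=
  fun i => KnotIsotopyInBoundary.refl_isSmall (hL.isBoundaryKnot i) (h𝒪 i)

end LinkIsotopyInBoundary

/-! ### Framings carried along an isotopy -/

section Framing

variable [IsManifold (𝓡∂ 4) ∞ W] {K K' : 𝕊 1 → W}

/-- **A framing `ν` of `K` carried along the isotopy `Φ` of knots in `∂W`**: a family `νt t`
of framings of the stages `Φ t` (`IsKnotFraming`: vector fields along the knot, tangent to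
`∂W`, nowhere tangent to the knot), continuous on `[0, 1] × S¹` as a map into the tangent
bundle, starting at `νt 0 = ν`.  The framing `νt 1` of `K'` is then the framing
"corresponding to `ν`" (the topological framing is unchanged along the isotopy). [folklore] -/
structure IsFramingAlong (Φ : KnotIsotopyInBoundary K K') (ν : 𝕊 1 → E4) (νt : ℝ → 𝕊 1 → E4) :
    Prop where
  /-- the family starts at `ν` -/
  apply_zero : νt 0 = ν
  /-- every stage `t ∈ [0, 1]` is a framing of the corresponding knot -/
  isKnotFraming : ∀ t ∈ Icc (0 : ℝ) 1, IsKnotFraming (Φ.toFun t) (νt t)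
  /-- joint continuity on `[0, 1] × S¹` into the tangent bundle -/
  continuousOn : ContinuousOn
    (fun p : ℝ × (𝕊 1) => (Bundle.TotalSpace.mk' E4 (Φ.toFun p.1 p.2) (νt p.1 p.2) :
      TangentBundle (𝓡∂ 4) W)) (Icc (0 : ℝ) 1 ×ˢ univ)

/-- A framing is carried along the constant isotopy by the constant family. [folklore] -/
theorem IsFramingAlong.refl (hK : IsBoundaryKnot K) {ν : 𝕊 1 → E4} (hν : IsKnotFraming K ν) :
    IsFramingAlong (KnotIsotopyInBoundary.refl hK) ν fun _ => ν where
  apply_zero := rfl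
  isKnotFraming _ _ := hν
  continuousOn := (hν.continuous.comp continuous_snd).continuousOn

/-- The carried framing at time `1` is a framing of the final knot. [folklore] -/
theorem IsFramingAlong.isKnotFraming_one {Φ : KnotIsotopyInBoundary K K'} {ν : 𝕊 1 → E4}
    {νt : ℝ → 𝕊 1 → E4} (h : IsFramingAlong Φ ν νt) : IsKnotFraming K' (νt 1) := by
  have h1 := h.isKnotFraming 1 ⟨zero_le_one, le_rfl⟩
  rwa [Φ.map_one] at h1

/-- The carried framing at time `0` is the given framing of the initial knot. [folklore] -/
theorem IsFramingAlong.isKnotFraming_zero {Φ : KnotIsotopyInBoundary K K'} {ν : 𝕊 1 → E4}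
    {νt : ℝ → 𝕊 1 → E4} (h : IsFramingAlong Φ ν νt) : IsKnotFraming K ν := by
  have h0 := h.isKnotFraming 0 ⟨le_rfl, zero_le_one⟩
  rwa [Φ.map_zero, h.apply_zero] at h0

end Framing

/-! ### The named fact -/

/-- **Stabilisation of Legendrian knots (Gompf 1998, §1; used in Akbulut–Matveyev 1998, §3).**
*"For any Legendrian knot `K`, we can find a `C⁰`-small isotopy (necessarily changing its
Legendrian knot type) that adds any number of left (negative) twists to the canonical framing —
or in the nullhomologous case, decreases `tb(K)` by any integer. (Simply add a spiral to `K`.)"*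
Recorded for the boundary of a compact (Hausdorff) Stein domain, on an arbitrary framing `ν`
of `K` carried along the isotopy (`IsFramingAlong`; see the module docstring): for every
`n : ℕ` and every open `𝒪 ⊆ S¹ × W` containing the graph of `K` there are a Legendrian knot
`K'`, an `𝒪`-small isotopy of knots in `∂W` from `K` to `K'` and a framing family `νt` along it
starting at `ν`, such that the twisting number of `νt 1` relative to the canonical framing of
`K'` is that of `ν` plus `n` (`SteinStructure.twisting`; `tb` decreases by `n`).
[cite: Gompf1998, §1] -/
def Gompf1998_addLeftTwists : Prop :=
  ∀ (W : Type) [TopologicalSpace W] [T2Space W] [ChartedSpace (EuclideanHalfSpace 4) W]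
    [IsManifold (𝓡∂ 4) ∞ W] [CompactSpace W] (S : SteinStructure W) (K : 𝕊 1 → W)
    (ν : 𝕊 1 → E4) (n : ℕ), IsLegendrianKnot S.J K → IsKnotFraming K ν →
    ∀ 𝒪 : Set ((𝕊 1) × W), IsOpen 𝒪 → (∀ u, (u, K u) ∈ 𝒪) →
    ∃ (K' : 𝕊 1 → W) (Φ : KnotIsotopyInBoundary K K') (νt : ℝ → 𝕊 1 → E4),
      IsLegendrianKnot S.J K' ∧ Φ.IsSmall 𝒪 ∧ IsFramingAlong Φ ν νt ∧
        S.twisting K' (νt 1) = S.twisting K ν + n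

/-! ### API -/

section API

variable {W : Type} [TopologicalSpace W] [T2Space W] [ChartedSpace (EuclideanHalfSpace 4) W]
  [IsManifold (𝓡∂ 4) ∞ W] [CompactSpace W]

omit [T2Space W] in
/-- Legendrian realisation in the trivial case of a link all of whose components are already
Legendrian: the constant isotopy is an `𝒪`-small isotopy of links in `∂W` to a Legendrian link,
for every family `𝒪` of sets containing the graphs of the components. [folklore] -/
theorem exists_linkIsotopyInBoundary_of_isLegendrianKnot (S : SteinStructure W) {ι : Type}
    {L : ι → 𝕊 1 → W} (hL : IsBoundaryLink L) (hLeg : ∀ i, IsLegendrianKnot S.J (L i))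
    {𝒪 : ι → Set ((𝕊 1) × W)} (h𝒪 : ∀ i u, (u, L i u) ∈ 𝒪 i) :
    ∃ (L' : ι → 𝕊 1 → W) (Φ : LinkIsotopyInBoundary L L'),
      (∀ i, IsLegendrianKnot S.J (L' i)) ∧ Φ.IsSmall 𝒪 :=
  ⟨L, LinkIsotopyInBoundary.refl hL, hLeg, LinkIsotopyInBoundary.refl_isSmall hL h𝒪⟩

omit [T2Space W] in
/-- The conclusion of `Gompf1998_addLeftTwists` for `n = 0`: the constant isotopy and the
constant framing family. [folklore] -/
theorem exists_knotIsotopyInBoundary_twisting_add_zero (S : SteinStructure W) {K : 𝕊 1 → W}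
    {ν : 𝕊 1 → E4} (hK : IsLegendrianKnot S.J K) (hν : IsKnotFraming K ν)
    {𝒪 : Set ((𝕊 1) × W)} (h𝒪 : ∀ u, (u, K u) ∈ 𝒪) :
    ∃ (K' : 𝕊 1 → W) (Φ : KnotIsotopyInBoundary K K') (νt : ℝ → 𝕊 1 → E4),
      IsLegendrianKnot S.J K' ∧ Φ.IsSmall 𝒪 ∧ IsFramingAlong Φ ν νt ∧
        S.twisting K' (νt 1) = S.twisting K ν + (0 : ℕ) :=
  ⟨K, KnotIsotopyInBoundary.refl hK.isBoundaryKnot, fun _ => ν, hK,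
    KnotIsotopyInBoundary.refl_isSmall hK.isBoundaryKnot h𝒪,
    IsFramingAlong.refl hK.isBoundaryKnot hν, by rw [Nat.cast_zero, add_zero]⟩

/-- **Defect zero ⇒ framing `tb - 1` after a `C⁰`-small isotopy (Akbulut–Matveyev 1998, §3,
from `Gompf1998_addLeftTwists`).**  *"If `tb(K) ≥ f + 1` then by `C⁰`-small smooth isotopy of
`K` we can decrease Thurston–Bennequin invariant of `K` and make it equal to `f + 1`"*: if the
framing `ν` of the Legendrian knot `K` has defect `0` (`SteinStructure.defect`, i.e. twisting
`≤ -1`, `SteinStructure.defect_eq_zero_iff`), then `K` is `𝒪`-small isotopic through knots in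
`∂W` to a Legendrian knot `K'` for which the carried framing has twisting exactly `-1` — the
framing "one less than Thurston–Bennequin" of Eliashberg's theorem (AM Thm. 2 (2); Gompf 1998,
Thm. 1.3 (c)).  Proof: add `-1 - twisting` left twists. [cite: AkbulutMatveyev1998, §3] -/
theorem Gompf1998_addLeftTwists.exists_twisting_eq_neg_one (h : Gompf1998_addLeftTwists)
    (S : SteinStructure W) {K : 𝕊 1 → W} {ν : 𝕊 1 → E4} (hK : IsLegendrianKnot S.J K)
    (hν : IsKnotFraming K ν) (hd : S.defect K ν = 0) {𝒪 : Set ((𝕊 1) × W)} (h𝒪 : IsOpen 𝒪)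
    (hK𝒪 : ∀ u, (u, K u) ∈ 𝒪) :
    ∃ (K' : 𝕊 1 → W) (Φ : KnotIsotopyInBoundary K K') (νt : ℝ → 𝕊 1 → E4),
      IsLegendrianKnot S.J K' ∧ Φ.IsSmall 𝒪 ∧ IsFramingAlong Φ ν νt ∧
        S.twisting K' (νt 1) = -1 := by
  have ht : S.twisting K ν ≤ -1 := (S.defect_eq_zero_iff K ν).1 hd
  obtain ⟨K', Φ, νt, h1, h2, h3, h4⟩ :=
    h W S K ν (-1 - S.twisting K ν).toNat hK hν 𝒪 h𝒪 hK𝒪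
  refine ⟨K', Φ, νt, h1, h2, h3, ?_⟩
  rw [h4, Int.toNat_of_nonneg (by omega)]
  ring

/-- Consequently (still under `Gompf1998_addLeftTwists`) the new framing has defect `0` as
well, now with equality `twisting = -1`. [cite: AkbulutMatveyev1998, §3] -/
theorem Gompf1998_addLeftTwists.exists_defect_eq_zero (h : Gompf1998_addLeftTwists)
    (S : SteinStructure W) {K : 𝕊 1 → W} {ν : 𝕊 1 → E4} (hK : IsLegendrianKnot S.J K)
    (hν : IsKnotFraming K ν) (hd : S.defect K ν = 0) {𝒪 : Set ((𝕊 1) × W)} (h𝒪 : IsOpen 𝒪)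
    (hK𝒪 : ∀ u, (u, K u) ∈ 𝒪) :
    ∃ (K' : 𝕊 1 → W) (Φ : KnotIsotopyInBoundary K K') (νt : ℝ → 𝕊 1 → E4),
      IsLegendrianKnot S.J K' ∧ Φ.IsSmall 𝒪 ∧ IsFramingAlong Φ ν νt ∧
        S.defect K' (νt 1) = 0 ∧ S.twisting K' (νt 1) = -1 := by
  obtain ⟨K', Φ, νt, h1, h2, h3, h4⟩ := h.exists_twisting_eq_neg_one S hK hν hd h𝒪 hK𝒪
  exact ⟨K', Φ, νt, h1, h2, h3, (S.defect_eq_zero_iff K' _).2 h4.le, h4⟩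

end API

end Literature.Geometry.Symplectic

end
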